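import Literature.MathematicalPhysics.QuantumFieldTheory.Balaban1983to89.B15PrelimIntegrations

/-!
# `Balaban1983to89.B15Rep163` — B15 p. 189: the representation (1.63) of the one-step boundary term `ℂ_k^{(n+1)}`
as a localized expansion over the GENERALIZED localization domains, with the four printed index conditions

statement-level skeleton of published theorems with citation tags; proofs where landed; nothing here is a claim about
the Yang–Mills mass gap.

CITATION HEADER (lean-in-tree rule 2026-08-18). T. Bałaban, *Large field renormalization. I. The basic step of the 𝐑
operation*, Comm. Math. Phys. **122**, 175–202 (1989) [Balaban1989LargeFieldI] (cell paper B15; PDF held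
`paper:balaban1989-cmp122-large-field-i`, journal page = PDF page + 174; the quotation below was read off the page
render p015 = journal p. 189, not the OCR).  The paper is a manuscript UNDER ADJUDICATION by the audit cell
`pub-balaban`; nothing of it is asserted here as a fact: this file contains DEFINITIONS (the printed index conditions
and the shape of the representation, as a schema over the cell's `Setup.LocExpansion`) and small theorems PROVED about
them — no `sorry`, no new axioms, no closed `def … : Prop` fact.  Reader/typer unit `lit-balaban-r12` (B15 owner),
generation 3; row `B15.Eq1.63` of `lit-balaban-r12/ROWS-B15.md`.

WHAT IS PRINTED (p. 189, verbatim).  *"The integral in (1.60) is of the same type as the integral studied in Sect. 3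
[III], therefore we can apply the results of this section and write the term ℂ_k^{(n+1)} as a sum of localized terms
with the corresponding exponential decay and analyticity properties. There is one peculiar feature of this expansion,
namely its localization domains are not from 𝔻_{j+1} only, but they are of a more general type, and can be described
by the following properties: X∩Ω^c_{j+2}∈𝔻_{j+1}, X∩(Ω_m∖Ω_{m+1})∈𝔻_m, m = j + 2,…,k (where Ω_{k+1} = ∅), and
X∩(Z_{j+1}∖Z″_{j+1}) ≠ ∅. For a given X there is a minimal index m such, that X ⊂ Ω^c_{m+1}. We take the smallest
domain from 𝔻_m containing X, and we resum over all X determining the same domain. As a result we obtain the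
representation  ℂ_k^{(n+1)} = Σ_X ℂ_k^{(n+1)}(X, U_k^{(n+1)}),  (1.63)  where the summation is over the localization
domains X satisfying the following properties: X ⊂ Ω^c_{m+1} for some m ≥ j + 1, X∩Ω_m ≠ ∅, X∈𝔻_m, and
X∩(Z_{j+1}∖Z″_{j+1}) ≠ ∅. The terms in the sum satisfy an exponential decay bound, which will be formulated later."*
(The bound "formulated later" is (1.70) p. 192 = `B15.PrelimIntegrations.Ineq170`.)

WHAT THIS FILE TYPES AND PROVES.  Points of the finest lattice are an abstract type `Λ` (in the cell's multi-scale
model `Λ = Site P 0` and the regions `Ω_m`, `Z_{j+1}`, `Z″_{j+1}` are the point sets of `…B15DeterminingSets`); the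
classes `𝔻_m` of localization domains of the `m`-th scale are an indexed family of sets of point sets (their cube
geometry is abstracted exactly as in `Setup.LocDomainSys`, DIVERGENCE F5).
* `Cond163 Ω 𝔻 Zj1 Zppj1 j m X` — the four printed conditions on a summation domain `X` of (1.63) at the scale `m`;
  `doms163` — the index set of the sum; `PreCond163` — the pre-resummation description (the sentence before (1.63)).
* PROVED: `Cond163.minimal` — the `m` of the conditions IS the printed *"minimal index m such, that X ⊂ Ω^c_{m+1}"*
  (for a decreasing sequence of regions), hence `Cond163.scale_unique`; `Cond163.scale_le` — with `Ω_{k+1} = ∅` the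
  scale satisfies `m ≤ k`; `Cond163.subset_compl` — `X ⊂ Ω^c_{m'}` for every `m' > m`.
* `Rep163 Φ Λ` — the DATA of the representation (1.63): a localized expansion `ℰ` (`Setup.LocExpansion`, terms
  `ℂ_k^{(n+1)}(X, ·)`) whose domains are realized as point sets `dom X` with a scale `scale X` satisfying `Cond163`,
  distinct domains having distinct point sets (*"we resum over all X determining the same domain"*);
  `Rep163.Represents R ℂ` — the displayed equation `ℂ = Σ_X ℂ(X, ·)`; `Rep163.Bound170` — the decay bound (1.70) of the
  terms, by NAME (`B15.PrelimIntegrations.Ineq170`, `d_m(X)` = the tree length carried by `ℰ.sys` at the domain's own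
  scale).  PROVED: `Rep163.norm_le_of_bound170` — (1.63) + (1.70) give `|ℂ(U)| ≤ Σ_X C₀ exp(−(1+3β)κ d_m(X))` on the
  analyticity domain; `Rep163.dom_mem_doms163`.
HONEST SCOPE.  Not typed: the construction of the expansion from Sect. 3 [III] (the cluster expansion itself), the
"smallest domain from 𝔻_m containing X" map and the resummation as an OPERATION (only its result — one term per domain —
is recorded, by `dom_injective`), and any property of the classes `𝔻_m`.

v1.1 (append-only, `lit-balaban-r12` gen 5): the framing sentence above (referee lint N1); §3 types the two printed
OPERATIONS of the sentence before (1.63) — the *"minimal index m such, that X ⊂ Ω^c_{m+1}"* (`minScale`, with its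
minimality, the bound `m ≤ k` from `Ω_{k+1} = ∅`, and *"X∩Ω_m ≠ ∅"* whenever `m > j + 1`, all PROVED) and the resummation
*"we resum over all X determining the same domain"* along an abstract closure map `cl` (`resum`, with `total_resum`:
the resummed expansion has the same total, PROVED by `Finset.sum_fiberwise`), and assembles a `Rep163` from a
pre-expansion and such a map (`Rep163.ofResum`, `Rep163.ofResum_represents`).  The closure map itself (*"the smallest
domain from 𝔻_m containing X"*) and the conditions satisfied by its values stay data / hypotheses: they are properties
of the abstract classes `𝔻_m`.
-/

namespace Literature.MathematicalPhysics.QuantumFieldTheory.Balaban1983to89.B15Rep163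

open scoped BigOperators

variable {Λ : Type*}

/-! ## 1. The printed index conditions -/

/-- The four printed conditions on a summation domain `X` of (1.63) at the scale `m`, p. 189: *"X ⊂ Ω^c_{m+1} for some
m ≥ j + 1, X∩Ω_m ≠ ∅, X∈𝔻_m, and X∩(Z_{j+1}∖Z″_{j+1}) ≠ ∅"* (`Ω m` = the region `Ω_m`, `𝔻 m` = the class of
localization domains of the `m`-th scale as a set of point sets, `Zj1 = Z_{j+1}`, `Zppj1 = Z″_{j+1}`).
[cite: Balaban1989LargeFieldI, (1.63) p.189] -/
def Cond163 (Ω : ℕ → Set Λ) (𝔻 : ℕ → Set (Set Λ)) (Zj1 Zppj1 : Set Λ) (j m : ℕ) (X : Set Λ) : Prop :=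
  j + 1 ≤ m ∧ X ⊆ (Ω (m + 1))ᶜ ∧ (X ∩ Ω m).Nonempty ∧ X ∈ 𝔻 m ∧ (X ∩ (Zj1 \ Zppj1)).Nonempty

/-- The index set of the sum (1.63): *"the summation is over the localization domains X satisfying the following
properties …"* — the point sets satisfying `Cond163` at some scale `m`. [cite: Balaban1989LargeFieldI, (1.63) p.189] -/
def doms163 (Ω : ℕ → Set Λ) (𝔻 : ℕ → Set (Set Λ)) (Zj1 Zppj1 : Set Λ) (j : ℕ) : Set (Set Λ) :=
  {X | ∃ m, Cond163 Ω 𝔻 Zj1 Zppj1 j m X}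

/-- The pre-resummation description of the localization domains, p. 189 (the sentence before (1.63)), verbatim:
*"X∩Ω^c_{j+2}∈𝔻_{j+1}, X∩(Ω_m∖Ω_{m+1})∈𝔻_m, m = j + 2,…,k (where Ω_{k+1} = ∅), and X∩(Z_{j+1}∖Z″_{j+1}) ≠ ∅"*
(typed as printed; how the classes `𝔻_m` treat an empty piece is a property of `𝔻`, not fixed here).
[cite: Balaban1989LargeFieldI, p.189] -/
def PreCond163 (Ω : ℕ → Set Λ) (𝔻 : ℕ → Set (Set Λ)) (Zj1 Zppj1 : Set Λ) (j k : ℕ) (X : Set Λ) : Prop :=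
  X ∩ (Ω (j + 2))ᶜ ∈ 𝔻 (j + 1) ∧ (∀ m, j + 2 ≤ m → m ≤ k → X ∩ (Ω m \ Ω (m + 1)) ∈ 𝔻 m) ∧
    (X ∩ (Zj1 \ Zppj1)).Nonempty

namespace Cond163

variable {Ω : ℕ → Set Λ} {𝔻 : ℕ → Set (Set Λ)} {Zj1 Zppj1 : Set Λ} {j m m' k : ℕ} {X : Set Λ}

/-- `m ≥ j + 1`. [cite: Balaban1989LargeFieldI, (1.63) p.189] -/
theorem le_scale (h : Cond163 Ω 𝔻 Zj1 Zppj1 j m X) : j + 1 ≤ m := h.1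

/-- `X ∈ 𝔻_m`. [cite: Balaban1989LargeFieldI, (1.63) p.189] -/
theorem mem_class (h : Cond163 Ω 𝔻 Zj1 Zppj1 j m X) : X ∈ 𝔻 m := h.2.2.2.1

/-- `X` meets the new large-field region `Z_{j+1} ∖ Z″_{j+1}`. [cite: Balaban1989LargeFieldI, (1.63) p.189] -/
theorem meets_new (h : Cond163 Ω 𝔻 Zj1 Zppj1 j m X) : (X ∩ (Zj1 \ Zppj1)).Nonempty := h.2.2.2.2

/-- A summation domain is nonempty (it meets `Ω_m`). [cite: Balaban1989LargeFieldI, (1.63) p.189] -/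
theorem nonempty (h : Cond163 Ω 𝔻 Zj1 Zppj1 j m X) : X.Nonempty :=
  h.2.2.1.mono Set.inter_subset_left

/-- The scale `m` of the conditions IS the printed *"minimal index m such, that X ⊂ Ω^c_{m+1}"*: for a decreasing
sequence of regions, `X ⊂ Ω^c_{m'+1}` forces `m ≤ m'` (because `X` meets `Ω_m ⊂ Ω_{m'+1}` when `m' < m`).
[cite: Balaban1989LargeFieldI, p.189] -/
theorem minimal (hΩ : Antitone Ω) (h : Cond163 Ω 𝔻 Zj1 Zppj1 j m X) (h' : X ⊆ (Ω (m' + 1))ᶜ) : m ≤ m' := by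
  refine le_of_not_gt fun hlt => ?_
  obtain ⟨x, hxX, hxΩ⟩ := h.2.2.1
  have hsub : Ω m ⊆ Ω (m' + 1) := hΩ (by omega)
  exact h' hxX (hsub hxΩ)

/-- Hence the scale of a summation domain is unique (decreasing regions). [cite: Balaban1989LargeFieldI, p.189] -/
theorem scale_unique (hΩ : Antitone Ω) (h : Cond163 Ω 𝔻 Zj1 Zppj1 j m X) (h' : Cond163 Ω 𝔻 Zj1 Zppj1 j m' X) :
    m = m' :=
  le_antisymm (h.minimal hΩ h'.2.1) (h'.minimal hΩ h.2.1)

/-- With the printed convention `Ω_{k+1} = ∅` (and decreasing regions) the scale satisfies `m ≤ k`: `X` meets `Ω_m`,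
which is empty for `m ≥ k + 1`. [cite: Balaban1989LargeFieldI, p.189] -/
theorem scale_le (hΩ : Antitone Ω) (hk : Ω (k + 1) = ∅) (h : Cond163 Ω 𝔻 Zj1 Zppj1 j m X) : m ≤ k := by
  refine le_of_not_gt fun hlt => ?_
  obtain ⟨x, -, hxΩ⟩ := h.2.2.1
  have hsub : Ω m ⊆ Ω (k + 1) := hΩ (by omega)
  have := hsub hxΩ
  rw [hk] at this
  exact this

/-- `X ⊂ Ω^c_{m'}` for every `m' > m` (decreasing regions). [cite: Balaban1989LargeFieldI, (1.63) p.189] -/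
theorem subset_compl (hΩ : Antitone Ω) (h : Cond163 Ω 𝔻 Zj1 Zppj1 j m X) (hm' : m < m') : X ⊆ (Ω m')ᶜ := by
  intro x hx hxΩ
  exact h.2.1 hx (hΩ (by omega) hxΩ)

/-- A domain satisfying the conditions belongs to the index set of (1.63). [cite: Balaban1989LargeFieldI, (1.63) p.189] -/
theorem mem_doms163 (h : Cond163 Ω 𝔻 Zj1 Zppj1 j m X) : X ∈ doms163 Ω 𝔻 Zj1 Zppj1 j := ⟨m, h⟩

end Cond163

/-! ## 2. The representation (1.63) as data over `Setup.LocExpansion` -/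

/-- The representation (1.63), p. 189: *"ℂ_k^{(n+1)} = Σ_X ℂ_k^{(n+1)}(X, U_k^{(n+1)}), where the summation is over
the localization domains X satisfying the following properties: X ⊂ Ω^c_{m+1} for some m ≥ j + 1, X∩Ω_m ≠ ∅, X∈𝔻_m,
and X∩(Z_{j+1}∖Z″_{j+1}) ≠ ∅"* — as DATA: the regions and classes, a localized expansion `ℰ` (terms
`ℂ_k^{(n+1)}(X, ·)` of configurations `Φ ∋ U_k^{(n+1)}`, `Setup.LocExpansion`, whose domain system carries the tree
lengths `d_m(X)` used in (1.70)), the point set `dom X` and the scale `scale X` of each summation domain, the printed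
conditions, and one term per point set (*"we resum over all X determining the same domain"*).
[cite: Balaban1989LargeFieldI, (1.63) p.189] -/
structure Rep163 (Φ : Type*) (Λ : Type*) where
  /-- the regions `Ω_m` (`Ω_{k+1} = ∅`) -/
  Ω : ℕ → Set Λ
  /-- the classes `𝔻_m` of localization domains of the `m`-th scale -/
  𝔻 : ℕ → Set (Set Λ)
  /-- `Z_{j+1}` -/
  Zj1 : Set Λ
  /-- `Z″_{j+1}` -/
  Zppj1 : Set Λ
  /-- the step index `j` -/
  j : ℕ
  /-- the localized expansion `X ↦ ℂ_k^{(n+1)}(X, ·)` -/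
  ℰ : LocExpansion Φ
  /-- the point set of a summation domain -/
  dom : ℰ.sys.Dom → Set Λ
  /-- its scale `m` -/
  scale : ℰ.sys.Dom → ℕ
  /-- the printed conditions -/
  cond : ∀ X, Cond163 Ω 𝔻 Zj1 Zppj1 j (scale X) (dom X)
  /-- one term per point set -/
  dom_injective : Function.Injective dom

namespace Rep163

variable {Φ : Type*} (R : Rep163 Φ Λ)

/-- The displayed equation (1.63): `ℂ(U) = Σ_X ℂ(X, U)` for every configuration `U` (= `U_k^{(n+1)}`).
[cite: Balaban1989LargeFieldI, (1.63) p.189] -/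
def Represents (C : Φ → ℂ) : Prop := ∀ U, C U = R.ℰ.total U

/-- *"The terms in the sum satisfy an exponential decay bound, which will be formulated later"* — (1.70) p. 192, by name:
`|ℂ(X, 𝕌)| ≤ C₀ exp(−(1+3β)κ d_m(X))` on the analyticity domain `𝒰`, `d_m(X) = ℰ.sys.dj X` at the domain's own scale
`m = scale X`. [cite: Balaban1989LargeFieldI, (1.70) p.192] -/
def Bound170 (𝒰 : Set Φ) (C₀ β κ : ℝ) : Prop := B15.PrelimIntegrations.Ineq170 R.ℰ 𝒰 C₀ β κ

/-- Every summation domain of the representation lies in the index set of (1.63). [cite: Balaban1989LargeFieldI, (1.63) p.189] -/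
theorem dom_mem_doms163 (X : R.ℰ.sys.Dom) : R.dom X ∈ doms163 R.Ω R.𝔻 R.Zj1 R.Zppj1 R.j := (R.cond X).mem_doms163

/-- The scale of each summation domain is at least `j + 1` and, with `Ω_{k+1} = ∅` and decreasing regions, at most `k`.
[cite: Balaban1989LargeFieldI, (1.63) p.189] -/
theorem scale_mem_Icc (hΩ : Antitone R.Ω) {k : ℕ} (hk : R.Ω (k + 1) = ∅) (X : R.ℰ.sys.Dom) :
    R.scale X ∈ Set.Icc (R.j + 1) k :=
  ⟨(R.cond X).le_scale, (R.cond X).scale_le hΩ hk⟩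

/-- (1.63) + (1.70): on the analyticity domain, `|ℂ(U)| ≤ Σ_X C₀ exp(−(1+3β)κ d_m(X))`.
[cite: Balaban1989LargeFieldI, (1.70) p.192] -/
theorem norm_le_of_bound170 {C : Φ → ℂ} {𝒰 : Set Φ} {C₀ β κ : ℝ} (hrep : R.Represents C)
    (hb : R.Bound170 𝒰 C₀ β κ) {U : Φ} (hU : U ∈ 𝒰) :
    ‖C U‖ ≤ ∑ X : R.ℰ.sys.Dom, C₀ * Real.exp (-((1 + 3 * β) * κ) * R.ℰ.sys.dj X) := by
  rw [hrep U, LocExpansion.total]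
  refine (norm_sum_le _ _).trans (Finset.sum_le_sum fun X _ => ?_)
  exact (B15.PrelimIntegrations.ineq170_iff R.ℰ 𝒰 C₀ β κ).mp hb X U hU

/-- In particular with `N` summation domains and `d_m(X) ≥ 0`, `κ(1+3β) ≥ 0`: `|ℂ(U)| ≤ N·C₀`.
[cite: Balaban1989LargeFieldI, (1.70) p.192] -/
theorem norm_le_card_mul {C : Φ → ℂ} {𝒰 : Set Φ} {C₀ β κ : ℝ} (hrep : R.Represents C)
    (hb : R.Bound170 𝒰 C₀ β κ) (hC₀ : 0 ≤ C₀) (hκ : 0 ≤ (1 + 3 * β) * κ) {U : Φ} (hU : U ∈ 𝒰) :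
    ‖C U‖ ≤ (Fintype.card R.ℰ.sys.Dom) * C₀ := by
  refine (R.norm_le_of_bound170 hrep hb hU).trans ?_
  have : ∀ X : R.ℰ.sys.Dom, C₀ * Real.exp (-((1 + 3 * β) * κ) * R.ℰ.sys.dj X) ≤ C₀ := by
    intro X
    have hd := R.ℰ.sys.dj_nonneg X
    have : Real.exp (-((1 + 3 * β) * κ) * R.ℰ.sys.dj X) ≤ 1 := by
      apply Real.exp_le_one_iff.mpr
      nlinarith
    nlinarith
  calc ∑ X : R.ℰ.sys.Dom, C₀ * Real.exp (-((1 + 3 * β) * κ) * R.ℰ.sys.dj X)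
      ≤ ∑ _X : R.ℰ.sys.Dom, C₀ := Finset.sum_le_sum fun X _ => this X
    _ = (Fintype.card R.ℰ.sys.Dom) * C₀ := by simp [Finset.sum_const, Finset.card_univ]

end Rep163

/-! ## 3. (v1.1) The two printed operations before (1.63): the minimal scale and the resummation

p. 189, verbatim: *"For a given X there is a minimal index m such, that X ⊂ Ω^c_{m+1}. We take the smallest domain from
𝔻_m containing X, and we resum over all X determining the same domain. As a result we obtain the representation (1.63)"*.
Here the first operation is `minScale` (a `Nat.find`), the second is `LocExpansion.resum` along an abstract map `cl`
(the *"smallest domain from 𝔻_m containing X"*, a datum: the cube geometry of the classes `𝔻_m` is not modelled, exactly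
as in `Setup.LocDomainSys`, DIVERGENCE F5), and `Rep163.ofResum` is the resulting representation (1.63). -/

section MinScale

variable {Ω : ℕ → Set Λ} {j k : ℕ} {X : Set Λ}

/-- The index condition of p. 189 at a candidate scale `m ≥ j + 1`: `X ⊂ Ω^c_{m+1}`. [cite: Balaban1989LargeFieldI, p.189] -/
def ScaleCond (Ω : ℕ → Set Λ) (j : ℕ) (X : Set Λ) (m : ℕ) : Prop := j + 1 ≤ m ∧ X ⊆ (Ω (m + 1))ᶜ

/-- With the printed convention `Ω_{k+1} = ∅` the scale `k` always qualifies (for `j + 1 ≤ k`), so a minimal index exists.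
[cite: Balaban1989LargeFieldI, p.189] -/
theorem scaleCond_top (hk : Ω (k + 1) = ∅) (hjk : j + 1 ≤ k) : ScaleCond Ω j X k :=
  ⟨hjk, fun x _ hx => by rw [hk] at hx; exact hx⟩

open Classical in
/-- *"For a given X there is a minimal index m such, that X ⊂ Ω^c_{m+1}"* (p. 189): the least `m ≥ j + 1` with
`X ⊆ (Ω (m+1))ᶜ`, which exists because `Ω_{k+1} = ∅` (`scaleCond_top`). [cite: Balaban1989LargeFieldI, p.189] -/
noncomputable def minScale (Ω : ℕ → Set Λ) (j k : ℕ) (X : Set Λ) (hk : Ω (k + 1) = ∅) (hjk : j + 1 ≤ k) : ℕ :=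
  Nat.find (⟨k, scaleCond_top hk hjk⟩ : ∃ m, ScaleCond Ω j X m)

/-- The minimal index satisfies the condition: `j + 1 ≤ m` and `X ⊆ (Ω (m+1))ᶜ`. [cite: Balaban1989LargeFieldI, p.189] -/
theorem scaleCond_minScale (hk : Ω (k + 1) = ∅) (hjk : j + 1 ≤ k) : ScaleCond Ω j X (minScale Ω j k X hk hjk) := by
  classical
  exact Nat.find_spec (⟨k, scaleCond_top hk hjk⟩ : ∃ m, ScaleCond Ω j X m)

/-- Minimality: any admissible scale is at least the minimal index. [cite: Balaban1989LargeFieldI, p.189] -/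
theorem minScale_le {m : ℕ} (hk : Ω (k + 1) = ∅) (hjk : j + 1 ≤ k) (hm : ScaleCond Ω j X m) :
    minScale Ω j k X hk hjk ≤ m := by
  classical
  exact Nat.find_min' _ hm

/-- Hence `j + 1 ≤ m ≤ k` for the minimal index `m`. [cite: Balaban1989LargeFieldI, p.189] -/
theorem minScale_mem_Icc (hk : Ω (k + 1) = ∅) (hjk : j + 1 ≤ k) : minScale Ω j k X hk hjk ∈ Set.Icc (j + 1) k :=
  ⟨(scaleCond_minScale hk hjk).1, minScale_le hk hjk (scaleCond_top hk hjk)⟩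

/-- If the minimal index `m` exceeds `j + 1`, then `X` MEETS `Ω_m` (the third printed condition of (1.63)): otherwise
`m − 1 ≥ j + 1` would be admissible. [cite: Balaban1989LargeFieldI, (1.63) p.189] -/
theorem inter_nonempty_of_lt_minScale (hk : Ω (k + 1) = ∅) (hjk : j + 1 ≤ k)
    (hlt : j + 1 < minScale Ω j k X hk hjk) : (X ∩ Ω (minScale Ω j k X hk hjk)).Nonempty := by
  by_contra h
  rw [Set.not_nonempty_iff_eq_empty] at h
  set m := minScale Ω j k X hk hjk with hm
  have hsub : X ⊆ (Ω (m - 1 + 1))ᶜ := by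
    have : m - 1 + 1 = m := by omega
    rw [this]
    intro x hx hxΩ
    have : x ∈ X ∩ Ω m := ⟨hx, hxΩ⟩
    rw [h] at this
    exact this
  have hle : m ≤ m - 1 := minScale_le hk hjk ⟨by omega, hsub⟩
  omega

/-- The minimal index is the unique admissible scale at which `X` meets `Ω_m` (cf. `Cond163.minimal`): if `X ⊆ (Ω (m+1))ᶜ`,
`j + 1 ≤ m` and `X ∩ Ω_m ≠ ∅` for decreasing regions, then `m` is the minimal index. [cite: Balaban1989LargeFieldI, p.189] -/
theorem minScale_eq_of_meets (hΩ : Antitone Ω) (hk : Ω (k + 1) = ∅) (hjk : j + 1 ≤ k) {m : ℕ} (hm : ScaleCond Ω j X m)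
    (hmeet : (X ∩ Ω m).Nonempty) : minScale Ω j k X hk hjk = m := by
  refine le_antisymm (minScale_le hk hjk hm) (le_of_not_gt fun hlt => ?_)
  obtain ⟨x, hxX, hxΩ⟩ := hmeet
  have hsub : Ω m ⊆ Ω (minScale Ω j k X hk hjk + 1) := hΩ (by omega)
  exact (scaleCond_minScale hk hjk).2 hxX (hsub hxΩ)

end MinScale

section Resummation

variable {Φ : Type*}

/-- RESUMMATION of a localized expansion along a map `cl` from its domains to a finite type `D'` of new domains with tree
lengths `dj'` (p. 189: `cl X` = *"the smallest domain from 𝔻_m containing X"*, and *"we resum over all X determining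
the same domain"*): the term of `Y` is the sum of the terms of all `X` with `cl X = Y` (an empty sum if none).
[cite: Balaban1989LargeFieldI, p.189] -/
noncomputable def resum (ℰ : LocExpansion Φ) {D' : Type} [Fintype D'] [DecidableEq D'] (cl : ℰ.sys.Dom → D')
    (dj' : D' → ℝ) (hdj' : ∀ Y, 0 ≤ dj' Y) : LocExpansion Φ where
  sys := { Dom := D', dj := dj', dj_nonneg := hdj' }
  E := fun Y φ => ∑ X ∈ Finset.univ.filter (fun X => cl X = Y), ℰ.E X φ

/-- The resummed term, unfolded (definitional). [cite: Balaban1989LargeFieldI, p.189] -/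
theorem resum_E (ℰ : LocExpansion Φ) {D' : Type} [Fintype D'] [DecidableEq D'] (cl : ℰ.sys.Dom → D')
    (dj' : D' → ℝ) (hdj' : ∀ Y, 0 ≤ dj' Y) (Y : D') (φ : Φ) :
    (resum ℰ cl dj' hdj').E Y φ = ∑ X ∈ Finset.univ.filter (fun X => cl X = Y), ℰ.E X φ := rfl

/-- **Resummation preserves the total**: `Σ_Y Σ_{X : cl X = Y} E(X, φ) = Σ_X E(X, φ)` — so the resummed expansion
represents the same function (*"As a result we obtain the representation (1.63)"*, p. 189). [cite: Balaban1989LargeFieldI, (1.63) p.189] -/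
theorem total_resum (ℰ : LocExpansion Φ) {D' : Type} [Fintype D'] [DecidableEq D'] (cl : ℰ.sys.Dom → D')
    (dj' : D' → ℝ) (hdj' : ∀ Y, 0 ≤ dj' Y) (φ : Φ) : (resum ℰ cl dj' hdj').total φ = ℰ.total φ := by
  unfold LocExpansion.total
  simp only [resum_E]
  exact Finset.sum_fiberwise Finset.univ cl fun X => ℰ.E X φ

/-- A term-wise bound survives resummation fibre by fibre: if `‖E(X, φ)‖ ≤ B X` then `‖E'(Y, φ)‖ ≤ Σ_{X : cl X = Y} B X`.
[cite: Balaban1989LargeFieldI, p.189] -/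
theorem norm_resum_E_le (ℰ : LocExpansion Φ) {D' : Type} [Fintype D'] [DecidableEq D'] (cl : ℰ.sys.Dom → D')
    (dj' : D' → ℝ) (hdj' : ∀ Y, 0 ≤ dj' Y) {B : ℰ.sys.Dom → ℝ} {φ : Φ} (hB : ∀ X, ‖ℰ.E X φ‖ ≤ B X) (Y : D') :
    ‖(resum ℰ cl dj' hdj').E Y φ‖ ≤ ∑ X ∈ Finset.univ.filter (fun X => cl X = Y), B X := by
  rw [resum_E]
  exact (norm_sum_le _ _).trans (Finset.sum_le_sum fun X _ => hB X)

end Resummation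

section OfResum

variable {Φ : Type*}

/-- **The representation (1.63) OBTAINED BY RESUMMATION** (p. 189): from a pre-expansion `ℰ` (the localized terms
delivered by Sect. 3 [III] for the integral (1.60)), the regions, and a map `cl` to new domains `D'` realized as point sets
`dom'` (injective: one term per point set) with scales `scale'` satisfying the printed conditions — *"we take the smallest
domain from 𝔻_m containing X, and we resum over all X determining the same domain"*. [cite: Balaban1989LargeFieldI, (1.63) p.189] -/
noncomputable def Rep163.ofResum (Ω : ℕ → Set Λ) (𝔻 : ℕ → Set (Set Λ)) (Zj1 Zppj1 : Set Λ) (j : ℕ)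
    (ℰ : LocExpansion Φ) {D' : Type} [Fintype D'] [DecidableEq D'] (cl : ℰ.sys.Dom → D') (dj' : D' → ℝ)
    (hdj' : ∀ Y, 0 ≤ dj' Y) (dom' : D' → Set Λ) (scale' : D' → ℕ)
    (cond' : ∀ Y, Cond163 Ω 𝔻 Zj1 Zppj1 j (scale' Y) (dom' Y)) (hinj : Function.Injective dom') : Rep163 Φ Λ where
  Ω := Ω
  𝔻 := 𝔻
  Zj1 := Zj1
  Zppj1 := Zppj1
  j := j
  ℰ := resum ℰ cl dj' hdj'
  dom := dom'
  scale := scale'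
  cond := cond'
  dom_injective := hinj

/-- The resummed representation represents every function the pre-expansion represents: `ℂ = Σ_X ℰ(X, ·)` gives
`ℂ = Σ_Y ℂ(Y, ·)` with the resummed terms — (1.63) as the RESULT of the printed resummation (`LocExpansion.total_resum`).
[cite: Balaban1989LargeFieldI, (1.63) p.189] -/
theorem Rep163.ofResum_represents {Ω : ℕ → Set Λ} {𝔻 : ℕ → Set (Set Λ)} {Zj1 Zppj1 : Set Λ} {j : ℕ}
    {ℰ : LocExpansion Φ} {D' : Type} [Fintype D'] [DecidableEq D'] {cl : ℰ.sys.Dom → D'} {dj' : D' → ℝ}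
    {hdj' : ∀ Y, 0 ≤ dj' Y} {dom' : D' → Set Λ} {scale' : D' → ℕ}
    {cond' : ∀ Y, Cond163 Ω 𝔻 Zj1 Zppj1 j (scale' Y) (dom' Y)} {hinj : Function.Injective dom'} {C : Φ → ℂ}
    (hC : ∀ U, C U = ℰ.total U) :
    (Rep163.ofResum Ω 𝔻 Zj1 Zppj1 j ℰ cl dj' hdj' dom' scale' cond' hinj).Represents C := by
  intro U
  rw [hC U]
  exact (total_resum ℰ cl dj' hdj' U).symm

/-- The scale bookkeeping of the resummation target, from `minScale`: if every new domain `Y` is given the minimal index of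
its point set, then the first two printed conditions of (1.63) hold for it — *"X ⊂ Ω^c_{m+1} for some m ≥ j + 1"* (and the
third, *"X∩Ω_m ≠ ∅"*, whenever that index exceeds `j + 1`: `inter_nonempty_of_lt_minScale`).
[cite: Balaban1989LargeFieldI, (1.63) p.189] -/
theorem scaleCond_of_minScale {Ω : ℕ → Set Λ} {j k : ℕ} (hk : Ω (k + 1) = ∅) (hjk : j + 1 ≤ k) (Y : Set Λ) :
    j + 1 ≤ minScale Ω j k Y hk hjk ∧ Y ⊆ (Ω (minScale Ω j k Y hk hjk + 1))ᶜ :=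
  scaleCond_minScale hk hjk

end OfResum

end Literature.MathematicalPhysics.QuantumFieldTheory.Balaban1983to89.B15Rep163
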